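import Summits.AtomisticToContinuum.BoseEinsteinCondensation.Theorems.BECThomsonPrincipleGDTransferSeededPlainInteractionPairs

/-!
# Route `BECThomsonPrinciple`, crux `GDTransfer` (stmt-AtomisticToContinuum-9482), line `seeded-continuity`:
# stub `stub_bandEmptinessBdd`, part 1 — weighted forms with a BOUNDED MEASURABLE weight

Support file (part 1) of the registered stub `stub_bandEmptinessBdd` of skeleton v6 (the plain-pair dichotomy
`gd_bandEmptiness` re-run with `IsFiniteContinuous` weakened to bounded measurability).  The landed calculus of
weighted forms `𝓥_w(f, g) = ∫_{cell^N} w · conj(f) g` (`…SeededPlainInteractionForms`) asks the real weight `w` to be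
CONTINUOUS; for a bounded measurable pair potential the pair weight `X ↦ v^per(x_p − x_q)` is only bounded and
measurable.  This file re-proves, with `Continuous w` replaced by `Measurable w ∧ ‖w‖ ≤ C` (suffix `_bdd`), exactly
the lemmas of that file which are consumed downstream with the pair weight:
* integrability of the integrand and finite sums in either slot and in the weight (`integrable_form_bdd`,
  `form_sum_left_bdd`, `form_sum_right_bdd`, `form_sum_weight_bdd`);
* the weighted square integral read in `ℝ≥0∞` and the WEIGHTED CAUCHY–SCHWARZ inequality
  (`ofReal_integral_weight_norm_sq_bdd`, `norm_form_le_sqrt_mul_sqrt_bdd`);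
* ADJOINTNESS of the slot operators `b_l = e_n(x_l)P_l`, `P_l^{(n)}` against a weight flat in slot `l`
  (`form_up_adjoint_bdd`, `form_down_adjoint_bdd`), resting on the one genuinely new leaf: **`P_i` is self-adjoint
  with one continuous and one bounded measurable entry** (`integral_conj_mul_cellAvg_bdd`, Fubini on
  `cell^{n+1} ≅ cell × cell^n` at slot `i` exactly as `Negative.integral_conj_mul_cellAvg`, integrability now from
  boundedness on the bounded cell instead of continuity);
* the `(i,j)`-expansion of the double-commutator form (`bracket_expand_bdd`); registered helper statement
  `plainFormsBdd_form_up_adjoint`.  All [folklore] (KennedyLiebShastry1988 §2; arXiv:1211.2778 §2; LSSY2005 App. A).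
-/

noncomputable section

open MeasureTheory Filter
open scoped ENNReal NNReal ComplexConjugate

namespace Summit.AtomisticToContinuum.BoseEinsteinCondensation.Cruxes.GDTransfer.Seeded

namespace PlainInteraction

open Literature.MathematicalPhysics.QuantumManyBody.BoseGas
open Summit.AtomisticToContinuum.BoseEinsteinCondensation.Theorems.GaussianDominationCan.Negative
open Summit.AtomisticToContinuum.BoseEinsteinCondensation.Cruxes.GDTransfer.DysonDressedWitness
open Lnss Sector

variable {N m : ℕ} {L : ℝ}

/-! ## Bounded measurable functions on the cell: three pieces of bookkeeping -/

/-- A continuous function is bounded on the (bounded) fundamental cell `cell^N`. [folklore] -/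
theorem exists_bound_on_cellN {E : Type*} [NormedAddCommGroup E] {g : Config N → E} (hg : Continuous g) (L : ℝ) :
    ∃ C : ℝ, ∀ X ∈ cellN N L, ‖g X‖ ≤ C := by
  obtain ⟨C, hC⟩ := (isCompact_closedBall (0 : Config N) (2 * |L|)).exists_bound_of_continuousOn hg.continuousOn
  exact ⟨C, fun X hX => hC X (cellN_subset_closedBall N L hX)⟩

/-- Filling slot `i` of a configuration of `cell^n` with a point of the cell gives a configuration of `cell^{n+1}`.
[folklore] -/
theorem insertNth_mem_cellN {n : ℕ} (i : Fin (n + 1)) {x : Space} (hx : x ∈ cell L) {Y : Config n}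
    (hY : Y ∈ cellN n L) : i.insertNth x Y ∈ cellN (n + 1) L := by
  refine (Fin.forall_iff_succAbove i).2 ⟨?_, fun j => ?_⟩
  · simpa only [Fin.insertNth_apply_same] using hx
  · simpa only [Fin.insertNth_apply_succAbove] using hY j

/-- The slice integral `Y ↦ ∫_cell h(X; x_i = x) dx` of a measurable function bounded on `cell^{n+1}` is strongly
measurable, and bounded by `C·|cell|` on `cell^n`. [folklore] -/
theorem sliceIntegral_bdd {n : ℕ} (i : Fin (n + 1)) {h : Config (n + 1) → ℂ} (hh : Measurable h) {C : ℝ}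
    (hC : ∀ X ∈ cellN (n + 1) L, ‖h X‖ ≤ C) :
    StronglyMeasurable (fun Y : Config n => ∫ x in cell L, h (i.insertNth x Y)) ∧
      ∀ Y ∈ cellN n L, ‖∫ x in cell L, h (i.insertNth x Y)‖ ≤ C * volume.real (cell L) := by
  have hm : Measurable fun p : Space × Config n => h (i.insertNth p.1 p.2) :=
    hh.comp (MeasurableEquiv.piFinSuccAbove (fun _ : Fin (n + 1) => Space) i).symm.measurable
  refine ⟨hm.stronglyMeasurable.integral_prod_left' (μ := (volume : Measure Space).restrict (cell L)),
    fun Y hY => ?_⟩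
  have hcell : volume (cell L) < ⊤ := by
    rw [volume_cell]; exact (ENNReal.pow_ne_top ENNReal.ofReal_ne_top).lt_top
  exact norm_setIntegral_le_of_norm_le_const hcell fun x hx => hC _ (insertNth_mem_cellN i hx hY)

/-! ## `P_i` is self-adjoint with one bounded measurable entry -/

/-- **`P_i` is self-adjoint, one entry continuous and one bounded measurable** (exchange of `x_i` with the dummy
variable): for continuous `f` and measurable `h` bounded on `cell^{n+1}`,
`∫ conj(f) · P_i h = ∫ conj(P_i f) · h` over `cell^{n+1}`. [folklore] -/
theorem integral_conj_mul_cellAvg_bdd {n : ℕ} (i : Fin (n + 1)) {f h : Config (n + 1) → ℂ}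
    (hf : Continuous f) (hh : Measurable h) {C : ℝ} (hC : ∀ X ∈ cellN (n + 1) L, ‖h X‖ ≤ C) :
    ∫ X in cellN (n + 1) L, conj (f X) * cellAvg (n + 1) L i h X =
      ∫ X in cellN (n + 1) L, conj (cellAvg (n + 1) L i f X) * h X := by
  -- adapted from `Negative.integral_conj_mul_cellAvg` (both entries continuous)
  set e := MeasurableEquiv.piFinSuccAbove (fun _ : Fin (n + 1) => Space) i with he_def
  set μ : Measure (Space × Config n) := ((volume : Measure Space).restrict (cell L)).prod
    ((volume : Measure (Config n)).restrict (cellN n L)) with hμ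
  have he : MeasurePreserving e ((volume : Measure (Config (n + 1))).restrict (cellN (n + 1) L)) μ :=
    measurePreserving_piFinSuccAbove_cellN (n := n) i L
  have hes : ∀ p : Space × Config n, e.symm p = i.insertNth p.1 p.2 := fun _ => rfl
  set c : ℝ := (L ^ 3)⁻¹ with hc
  set Fbar : Config n → ℂ := fun Y => ∫ x in cell L, f (i.insertNth x Y) with hFbar
  set Gbar : Config n → ℂ := fun Y => ∫ x in cell L, h (i.insertNth x Y) with hGbar
  have hFc : Continuous Fbar := continuous_setIntegral_insertNth i hf
  obtain ⟨hGm, hGb⟩ := sliceIntegral_bdd (L := L) i hh hC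
  have hPg : ∀ p : Space × Config n, cellAvg (n + 1) L i h (e.symm p) = c • Gbar p.2 := by
    intro p; rw [hes]; unfold cellAvg; simp only [Fin.update_insertNth]; rfl
  have hPf : ∀ p : Space × Config n, cellAvg (n + 1) L i f (e.symm p) = c • Fbar p.2 := by
    intro p; rw [hes]; unfold cellAvg; simp only [Fin.update_insertNth]; rfl
  have hrem : Continuous fun X : Config (n + 1) => (fun j : Fin n => X (i.succAbove j)) := by fun_prop
  -- the two a.e. membership facts on the product
  have hae1 : ∀ᵐ p ∂μ, p.1 ∈ cell L :=
    (Measure.quasiMeasurePreserving_fst (μ := (volume : Measure Space).restrict (cell L))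
      (ν := (volume : Measure (Config n)).restrict (cellN n L))).ae (ae_restrict_mem (measurableSet_cell L))
  have hae2 : ∀ᵐ p ∂μ, p.2 ∈ cellN n L :=
    (Measure.quasiMeasurePreserving_snd (μ := (volume : Measure Space).restrict (cell L))
      (ν := (volume : Measure (Config n)).restrict (cellN n L))).ae (ae_restrict_mem (measurableSet_cellN n L))
  -- transport the two integrals to the product space
  have hLHS := (he.symm e).integral_comp' (fun X => conj (f X) * cellAvg (n + 1) L i h X)
  have hRHS := (he.symm e).integral_comp' (fun X => conj (cellAvg (n + 1) L i f X) * h X)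
  rw [← hLHS, ← hRHS]
  simp only [hPg, hPf]
  simp only [hes]
  have hhm : AEStronglyMeasurable (fun p : Space × Config n => h (i.insertNth p.1 p.2)) μ :=
    (hh.comp e.symm.measurable).aestronglyMeasurable
  -- integrability on the product
  have hint1 : Integrable (fun p : Space × Config n =>
      conj (f (i.insertNth p.1 p.2)) * (c • Gbar p.2)) μ := by
    have hc1 : Continuous (fun X : Config (n + 1) => conj (f X)) := Complex.continuous_conj.comp hf
    have h3 := ((he.symm e).integrable_comp_emb e.symm.measurableEmbedding).mpr (integrableOn_cellN hc1 L)
    have h4 : Integrable (fun p : Space × Config n => conj (f (i.insertNth p.1 p.2))) μ :=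
      h3.congr (Eventually.of_forall fun p => by simp only [Function.comp_apply, hes])
    refine h4.mul_bdd ((hGm.comp_measurable measurable_snd).aestronglyMeasurable.const_smul c)
      (c := ‖c‖ * (C * volume.real (cell L))) (hae2.mono fun p hp => ?_)
    rw [norm_smul]
    exact mul_le_mul_of_nonneg_left (hGb p.2 hp) (norm_nonneg _)
  have hint2 : Integrable (fun p : Space × Config n =>
      conj (c • Fbar p.2) * h (i.insertNth p.1 p.2)) μ := by
    have hc2 : Continuous (fun X : Config (n + 1) => conj (c • Fbar (fun j : Fin n => X (i.succAbove j)))) :=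
      Complex.continuous_conj.comp ((hFc.comp hrem).const_smul c)
    have h3 := ((he.symm e).integrable_comp_emb e.symm.measurableEmbedding).mpr (integrableOn_cellN hc2 L)
    have h4 : Integrable (fun p : Space × Config n => conj (c • Fbar p.2)) μ :=
      h3.congr (Eventually.of_forall fun p => by
        simp only [Function.comp_apply, hes, Fin.insertNth_apply_succAbove])
    refine h4.mul_bdd hhm (c := C) ?_
    filter_upwards [hae1, hae2] with p hp1 hp2
    exact hC _ (insertNth_mem_cellN i hp1 hp2)
  rw [integral_prod_symm _ hint1, integral_prod_symm _ hint2]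
  refine integral_congr_ae (Eventually.of_forall fun Y => ?_)
  simp only
  rw [integral_mul_const, integral_const_mul, integral_conj]
  show conj (Fbar Y) * (c • Gbar Y) = conj (c • Fbar Y) * Gbar Y
  rw [Complex.real_smul, Complex.real_smul, map_mul, Complex.conj_ofReal]
  ring

/-! ## Weighted forms `∫ w conj(f) g` with a bounded measurable weight -/

section BddWeight

variable {w : Config N → ℝ} {C : ℝ}

/-- The integrand of a weighted form with bounded measurable weight and continuous entries is integrable on the
cell. [folklore] -/
theorem integrable_form_bdd (hw : Measurable w) (hwb : ∀ X, ‖w X‖ ≤ C) {f g : Config N → ℂ} (hf : Continuous f)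
    (hg : Continuous g) :
    Integrable (fun X => ((w X : ℝ) : ℂ) * (conj (f X) * g X))
      ((volume : Measure (Config N)).restrict (cellN N L)) :=
  (integrableOn_cellN ((Complex.continuous_conj.comp hf).mul hg) L).bdd_mul
    (Complex.measurable_ofReal.comp hw).aestronglyMeasurable
    (Eventually.of_forall fun X => by rw [Complex.norm_real]; exact hwb X)

/-- **Finite sums in the first slot** (bounded measurable weight). [folklore] -/
theorem form_sum_left_bdd {ι : Type*} (s : Finset ι) (hw : Measurable w) (hwb : ∀ X, ‖w X‖ ≤ C)
    {f : ι → Config N → ℂ} (hf : ∀ i ∈ s, Continuous (f i)) {g : Config N → ℂ} (hg : Continuous g) :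
    ∫ X in cellN N L, ((w X : ℝ) : ℂ) * (conj (∑ i ∈ s, f i X) * g X) =
      ∑ i ∈ s, ∫ X in cellN N L, ((w X : ℝ) : ℂ) * (conj (f i X) * g X) := by
  rw [← integral_finsetSum s fun i hi => integrable_form_bdd hw hwb (hf i hi) hg]
  refine integral_congr_ae (Eventually.of_forall fun X => ?_)
  simp only [map_sum, Finset.sum_mul, Finset.mul_sum]

/-- **Finite sums in the second slot** (bounded measurable weight). [folklore] -/
theorem form_sum_right_bdd {ι : Type*} (s : Finset ι) (hw : Measurable w) (hwb : ∀ X, ‖w X‖ ≤ C)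
    {f : Config N → ℂ} (hf : Continuous f) {g : ι → Config N → ℂ} (hg : ∀ i ∈ s, Continuous (g i)) :
    ∫ X in cellN N L, ((w X : ℝ) : ℂ) * (conj (f X) * ∑ i ∈ s, g i X) =
      ∑ i ∈ s, ∫ X in cellN N L, ((w X : ℝ) : ℂ) * (conj (f X) * g i X) := by
  rw [← integral_finsetSum s fun i hi => integrable_form_bdd hw hwb hf (hg i hi)]
  refine integral_congr_ae (Eventually.of_forall fun X => ?_)
  simp only [Finset.mul_sum]

/-- **Finite sums in the weight** (bounded measurable weights). [folklore] -/
theorem form_sum_weight_bdd {ι : Type*} (s : Finset ι) {w : ι → Config N → ℝ} (hw : ∀ k ∈ s, Measurable (w k))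
    (hwb : ∀ k ∈ s, ∀ X, ‖w k X‖ ≤ C) {f g : Config N → ℂ} (hf : Continuous f) (hg : Continuous g) :
    ∫ X in cellN N L, ((∑ k ∈ s, w k X : ℝ) : ℂ) * (conj (f X) * g X) =
      ∑ k ∈ s, ∫ X in cellN N L, ((w k X : ℝ) : ℂ) * (conj (f X) * g X) := by
  rw [← integral_finsetSum s fun k hk => integrable_form_bdd (hw k hk) (hwb k hk) hf hg]
  refine integral_congr_ae (Eventually.of_forall fun X => ?_)
  simp only [Complex.ofReal_sum, Finset.sum_mul]

/-- The real weighted square integral `∫ w|f|²` read in `ℝ≥0∞`, for a bounded measurable weight `w ≥ 0` and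
continuous `f`: `ofReal (∫ w|f|²) = ∫⁻ ofReal(w)·‖f‖₊²`. [folklore] -/
theorem ofReal_integral_weight_norm_sq_bdd (hw : Measurable w) (hwb : ∀ X, ‖w X‖ ≤ C) (hw0 : ∀ X, 0 ≤ w X)
    {f : Config N → ℂ} (hf : Continuous f) :
    ENNReal.ofReal (∫ X in cellN N L, w X * ‖f X‖ ^ 2) =
      ∫⁻ X in cellN N L, ENNReal.ofReal (w X) * ((‖f X‖₊ : ℝ≥0∞)) ^ 2 := by
  have hint : Integrable (fun X => w X * ‖f X‖ ^ 2) ((volume : Measure (Config N)).restrict (cellN N L)) :=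
    (integrableOn_cellN (hf.norm.pow 2) L).bdd_mul hw.aestronglyMeasurable (Eventually.of_forall hwb)
  rw [ofReal_integral_eq_lintegral_ofReal hint (Eventually.of_forall fun X => mul_nonneg (hw0 X) (sq_nonneg _))]
  refine lintegral_congr fun X => ?_
  rw [ENNReal.ofReal_mul (hw0 X), coe_nnnorm_sq_eq_ofReal]

/-- **Weighted Cauchy–Schwarz** for a bounded measurable weight `w ≥ 0` and continuous `f, g`:
`|∫ w conj(f) g| ≤ √(∫ w|f|²) · √(∫ w|g|²)` (Hölder `2,2` in `ℝ≥0∞` for `√w|f|`, `√w|g|`). [folklore] -/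
theorem norm_form_le_sqrt_mul_sqrt_bdd (hw : Measurable w) (hwb : ∀ X, ‖w X‖ ≤ C) (hw0 : ∀ X, 0 ≤ w X)
    {f g : Config N → ℂ} (hf : Continuous f) (hg : Continuous g) :
    ‖∫ X in cellN N L, ((w X : ℝ) : ℂ) * (conj (f X) * g X)‖ ≤
      Real.sqrt (∫ X in cellN N L, w X * ‖f X‖ ^ 2) * Real.sqrt (∫ X in cellN N L, w X * ‖g X‖ ^ 2) := by
  -- adapted from `norm_form_le_sqrt_mul_sqrt` (continuous weight)
  set μ : Measure (Config N) := (volume : Measure (Config N)).restrict (cellN N L) with hμ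
  set A : ℝ := ∫ X in cellN N L, w X * ‖f X‖ ^ 2 with hA
  set B : ℝ := ∫ X in cellN N L, w X * ‖g X‖ ^ 2 with hB
  have hA0 : 0 ≤ A := integral_nonneg fun X => mul_nonneg (hw0 X) (sq_nonneg _)
  have hB0 : 0 ≤ B := integral_nonneg fun X => mul_nonneg (hw0 X) (sq_nonneg _)
  set F : Config N → ℝ≥0∞ := fun X => ENNReal.ofReal (Real.sqrt (w X)) * (‖f X‖₊ : ℝ≥0∞) with hF
  set G : Config N → ℝ≥0∞ := fun X => ENNReal.ofReal (Real.sqrt (w X)) * (‖g X‖₊ : ℝ≥0∞) with hG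
  have hsw : Measurable fun X => ENNReal.ofReal (Real.sqrt (w X)) :=
    ENNReal.measurable_ofReal.comp (Real.continuous_sqrt.measurable.comp hw)
  have hFm : AEMeasurable F μ := (hsw.mul hf.measurable.nnnorm.coe_nnreal_ennreal).aemeasurable
  have hGm : AEMeasurable G μ := (hsw.mul hg.measurable.nnnorm.coe_nnreal_ennreal).aemeasurable
  have hsq : ∀ X, ENNReal.ofReal (Real.sqrt (w X)) ^ 2 = ENNReal.ofReal (w X) := fun X => by
    rw [← ENNReal.ofReal_pow (Real.sqrt_nonneg _), Real.sq_sqrt (hw0 X)]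
  have hF2 : ∫⁻ X, F X ^ 2 ∂μ = ENNReal.ofReal A := by
    rw [hA, ofReal_integral_weight_norm_sq_bdd hw hwb hw0 hf]
    exact lintegral_congr fun X => by rw [hF, mul_pow, hsq]
  have hG2 : ∫⁻ X, G X ^ 2 ∂μ = ENNReal.ofReal B := by
    rw [hB, ofReal_integral_weight_norm_sq_bdd hw hwb hw0 hg]
    exact lintegral_congr fun X => by rw [hG, mul_pow, hsq]
  have hnorm : ∀ X, ‖((w X : ℝ) : ℂ) * (conj (f X) * g X)‖ₑ = F X * G X := by
    intro X
    have hww : Real.sqrt (w X) * ‖f X‖ * (Real.sqrt (w X) * ‖g X‖) = w X * (‖f X‖ * ‖g X‖) := by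
      have h := Real.mul_self_sqrt (hw0 X)
      linear_combination (‖f X‖ * ‖g X‖) * h
    calc ‖((w X : ℝ) : ℂ) * (conj (f X) * g X)‖ₑ
        = ENNReal.ofReal (w X * (‖f X‖ * ‖g X‖)) := by
          rw [← ofReal_norm, norm_mul, norm_mul, Complex.norm_conj, Complex.norm_real,
            Real.norm_of_nonneg (hw0 X)]
      _ = F X * G X := by
          rw [← hww, hF, hG]
          simp only
          rw [ENNReal.ofReal_mul (mul_nonneg (Real.sqrt_nonneg _) (norm_nonneg _)),
            ENNReal.ofReal_mul (Real.sqrt_nonneg _), ENNReal.ofReal_mul (Real.sqrt_nonneg _),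
            ofReal_norm, ofReal_norm, enorm_eq_nnnorm, enorm_eq_nnnorm]
  have key : (‖∫ X, ((w X : ℝ) : ℂ) * (conj (f X) * g X) ∂μ‖ₑ) ≤
      ENNReal.ofReal (Real.sqrt A * Real.sqrt B) := by
    calc (‖∫ X, ((w X : ℝ) : ℂ) * (conj (f X) * g X) ∂μ‖ₑ)
        ≤ ∫⁻ X, ‖((w X : ℝ) : ℂ) * (conj (f X) * g X)‖ₑ ∂μ := enorm_integral_le_lintegral_enorm _
      _ = ∫⁻ X, (F * G) X ∂μ := lintegral_congr fun X => by rw [hnorm, Pi.mul_apply]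
      _ ≤ (∫⁻ X, F X ^ (2 : ℝ) ∂μ) ^ (1 / (2 : ℝ)) * (∫⁻ X, G X ^ (2 : ℝ) ∂μ) ^ (1 / (2 : ℝ)) :=
          ENNReal.lintegral_mul_le_Lp_mul_Lq μ Real.HolderConjugate.two_two hFm hGm
      _ = ENNReal.ofReal A ^ (1 / (2 : ℝ)) * ENNReal.ofReal B ^ (1 / (2 : ℝ)) := by
          simp only [ENNReal.rpow_two, hF2, hG2]
      _ = ENNReal.ofReal (Real.sqrt A * Real.sqrt B) := by
          rw [Real.sqrt_eq_rpow, Real.sqrt_eq_rpow, ENNReal.ofReal_mul (Real.rpow_nonneg hA0 _),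
            ENNReal.ofReal_rpow_of_nonneg hA0 (by norm_num), ENNReal.ofReal_rpow_of_nonneg hB0 (by norm_num)]
  rw [← ofReal_norm] at key
  exact (ENNReal.ofReal_le_ofReal_iff (mul_nonneg (Real.sqrt_nonneg _) (Real.sqrt_nonneg _))).1 key

end BddWeight

/-! ## Adjointness of the slot operators against a bounded measurable weight flat in the slot -/

section Adjoint

variable {w : Config (m + 1) → ℝ} {C : ℝ}

/-- **`𝓥_w(b_l f, g) = 𝓥_w(f, P_l^{(n)} g)`** for a bounded measurable real weight `w` flat in slot `l` and continuous
`f, g` (`P_l` is self-adjoint with one bounded measurable entry, and `w` passes through `P_l`). [folklore] -/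
theorem form_up_adjoint_bdd (n : Fin 3 → ℤ) (l : Fin (m + 1)) (hw : Measurable w) (hwb : ∀ X, ‖w X‖ ≤ C)
    (hwl : ∀ X z, w (Function.update X l z) = w X) {f g : Config (m + 1) → ℂ} (hf : Continuous f)
    (hg : Continuous g) :
    ∫ X in cellN (m + 1) L, ((w X : ℝ) : ℂ) *
        (conj (cellWave L n (X l) * cellAvg (m + 1) L l f X) * g X) =
      ∫ X in cellN (m + 1) L, ((w X : ℝ) : ℂ) * (conj (f X) * fourierAvg m L n l g X) := by
  -- adapted from `form_up_adjoint` (continuous weight)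
  set h : Config (m + 1) → ℂ := fun X => conj (cellWave L n (X l)) * (((w X : ℝ) : ℂ) * g X) with hh
  have hhm : Measurable h :=
    (Complex.continuous_conj.measurable.comp ((continuous_cellWave L n).measurable.comp (measurable_pi_apply l))).mul
      ((Complex.measurable_ofReal.comp hw).mul hg.measurable)
  obtain ⟨Cg, hCg⟩ := exists_bound_on_cellN hg L
  have hhb : ∀ X ∈ cellN (m + 1) L, ‖h X‖ ≤ C * Cg := fun X hX => by
    rw [hh]
    simp only
    rw [norm_mul, Complex.norm_conj, norm_cellWave, one_mul, norm_mul, Complex.norm_real]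
    exact mul_le_mul (hwb X) (hCg X hX) (norm_nonneg _) ((norm_nonneg _).trans (hwb X))
  have hwu : ∀ (X : Config (m + 1)) (z : Space),
      (((w (Function.update X l z) : ℝ) : ℂ)) = ((w X : ℝ) : ℂ) := fun X z => by rw [hwl]
  have hPh : cellAvg (m + 1) L l h = fun X => ((w X : ℝ) : ℂ) * fourierAvg m L n l g X := by
    rw [hh, cellAvg_conj_cellWave_mul n l, fourierAvg_mul_flat n l hwu g]
  calc ∫ X in cellN (m + 1) L, ((w X : ℝ) : ℂ) *
        (conj (cellWave L n (X l) * cellAvg (m + 1) L l f X) * g X)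
      = ∫ X in cellN (m + 1) L, conj (cellAvg (m + 1) L l f X) * h X := by
        refine integral_congr_ae (Eventually.of_forall fun X => ?_)
        simp only [hh, map_mul]
        ring
    _ = ∫ X in cellN (m + 1) L, conj (f X) * cellAvg (m + 1) L l h X :=
        (integral_conj_mul_cellAvg_bdd l hf hhm hhb).symm
    _ = ∫ X in cellN (m + 1) L, ((w X : ℝ) : ℂ) * (conj (f X) * fourierAvg m L n l g X) := by
        rw [hPh]
        refine integral_congr_ae (Eventually.of_forall fun X => ?_)
        simp only
        ring

/-- **`𝓥_w(P_l^{(n)} f, g) = 𝓥_w(f, b_l g)`** (the conjugate-symmetric companion of `form_up_adjoint_bdd`).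
[folklore] -/
theorem form_down_adjoint_bdd (n : Fin 3 → ℤ) (l : Fin (m + 1)) (hw : Measurable w) (hwb : ∀ X, ‖w X‖ ≤ C)
    (hwl : ∀ X z, w (Function.update X l z) = w X) {f g : Config (m + 1) → ℂ} (hf : Continuous f)
    (hg : Continuous g) :
    ∫ X in cellN (m + 1) L, ((w X : ℝ) : ℂ) * (conj (fourierAvg m L n l f X) * g X) =
      ∫ X in cellN (m + 1) L, ((w X : ℝ) : ℂ) *
        (conj (f X) * (cellWave L n (X l) * cellAvg (m + 1) L l g X)) := by
  rw [form_conj_symm w g (fourierAvg m L n l f), ← form_up_adjoint_bdd n l hw hwb hwl hg hf,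
    ← form_conj_symm w _ f]

/-! ## The `(i,j)`-expansion of the double-commutator form for a bounded measurable weight -/

/-- **Expansion** (bounded measurable weight `w`, continuous `ψ`), with `B = Σ_i b_i`, `B' = Σ_i P_i^{(n)}`:
`𝓥_w(Bψ,Bψ) + 𝓥_w(B'ψ,B'ψ) − 𝓥_w(BB'ψ,ψ) − 𝓥_w(B'Bψ,ψ) = Σ_{i,j}[𝓥_w(b_iψ,b_jψ) + 𝓥_w(P_i^{(n)}ψ,P_j^{(n)}ψ)
− 𝓥_w(b_iP_j^{(n)}ψ,ψ) − 𝓥_w(P_i^{(n)}b_jψ,ψ)]`. [folklore] -/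
theorem bracket_expand_bdd (hw : Measurable w) (hwb : ∀ X, ‖w X‖ ≤ C) (n : Fin 3 → ℤ)
    {ψ : Config (m + 1) → ℂ} (hψ : Continuous ψ) :
    ((∫ X in cellN (m + 1) L, ((w X : ℝ) : ℂ) *
        (conj (∑ i, cellWave L n (X i) * cellAvg (m + 1) L i ψ X) *
          ∑ i, cellWave L n (X i) * cellAvg (m + 1) L i ψ X)) +
      (∫ X in cellN (m + 1) L, ((w X : ℝ) : ℂ) *
        (conj (∑ i, fourierAvg m L n i ψ X) * ∑ i, fourierAvg m L n i ψ X)) -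
      (∫ X in cellN (m + 1) L, ((w X : ℝ) : ℂ) *
        (conj (∑ i, cellWave L n (X i) *
          cellAvg (m + 1) L i (fun Y => ∑ j, fourierAvg m L n j ψ Y) X) * ψ X)) -
      ∫ X in cellN (m + 1) L, ((w X : ℝ) : ℂ) *
        (conj (∑ i, fourierAvg m L n i (fun Y => ∑ j, cellWave L n (Y j) * cellAvg (m + 1) L j ψ Y) X) *
          ψ X)) =
      ∑ i, ∑ j,
        ((∫ X in cellN (m + 1) L, ((w X : ℝ) : ℂ) *
            (conj (cellWave L n (X i) * cellAvg (m + 1) L i ψ X) *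
              (cellWave L n (X j) * cellAvg (m + 1) L j ψ X))) +
          (∫ X in cellN (m + 1) L, ((w X : ℝ) : ℂ) * (conj (fourierAvg m L n i ψ X) * fourierAvg m L n j ψ X)) -
          (∫ X in cellN (m + 1) L, ((w X : ℝ) : ℂ) *
            (conj (cellWave L n (X i) * cellAvg (m + 1) L i (fourierAvg m L n j ψ) X) * ψ X)) -
          ∫ X in cellN (m + 1) L, ((w X : ℝ) : ℂ) *
            (conj (fourierAvg m L n i (fun Y => cellWave L n (Y j) * cellAvg (m + 1) L j ψ Y) X) * ψ X)) := by
  -- adapted from `bracket_expand` (continuous weight)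
  have hb : ∀ i, Continuous fun X => cellWave L n (X i) * cellAvg (m + 1) L i ψ X := fun i => continuous_up n i hψ
  have hF : ∀ i, Continuous (fourierAvg m L n i ψ) := fun i => continuous_fourierAvg n i hψ
  have hbF : ∀ i j, Continuous fun X => cellWave L n (X i) * cellAvg (m + 1) L i (fourierAvg m L n j ψ) X :=
    fun i j => continuous_up n i (hF j)
  have hFb : ∀ i j, Continuous (fourierAvg m L n i fun Y => cellWave L n (Y j) * cellAvg (m + 1) L j ψ Y) :=
    fun i j => continuous_fourierAvg n i (hb j)
  have hBB' : (fun X => ∑ i, cellWave L n (X i) * cellAvg (m + 1) L i (fun Y => ∑ j, fourierAvg m L n j ψ Y) X) =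
      fun X => ∑ i, ∑ j, cellWave L n (X i) * cellAvg (m + 1) L i (fourierAvg m L n j ψ) X := by
    funext X
    refine Finset.sum_congr rfl fun i _ => ?_
    rw [cellAvg_sum Finset.univ (fun j _ => hF j) i, Finset.mul_sum]
  have hB'B : (fun X => ∑ i, fourierAvg m L n i (fun Y => ∑ j, cellWave L n (Y j) * cellAvg (m + 1) L j ψ Y) X) =
      fun X => ∑ i, ∑ j, fourierAvg m L n i (fun Y => cellWave L n (Y j) * cellAvg (m + 1) L j ψ Y) X := by
    funext X
    refine Finset.sum_congr rfl fun i _ => ?_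
    rw [fourierAvg_sum Finset.univ n (fun j _ => hb j) i]
  have e3 : (∫ X in cellN (m + 1) L, ((w X : ℝ) : ℂ) *
      (conj (∑ i, cellWave L n (X i) * cellAvg (m + 1) L i (fun Y => ∑ j, fourierAvg m L n j ψ Y) X) * ψ X)) =
        ∑ i, ∑ j, ∫ X in cellN (m + 1) L, ((w X : ℝ) : ℂ) *
          (conj (cellWave L n (X i) * cellAvg (m + 1) L i (fourierAvg m L n j ψ) X) * ψ X) := by
    have h := congrFun hBB'
    simp_rw [h]
    rw [form_sum_left_bdd _ hw hwb (fun i _ => continuous_finsetSum _ fun j _ => hbF i j) hψ]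
    exact Finset.sum_congr rfl fun i _ => form_sum_left_bdd _ hw hwb (fun j _ => hbF i j) hψ
  have e4 : (∫ X in cellN (m + 1) L, ((w X : ℝ) : ℂ) *
      (conj (∑ i, fourierAvg m L n i (fun Y => ∑ j, cellWave L n (Y j) * cellAvg (m + 1) L j ψ Y) X) * ψ X)) =
        ∑ i, ∑ j, ∫ X in cellN (m + 1) L, ((w X : ℝ) : ℂ) *
          (conj (fourierAvg m L n i (fun Y => cellWave L n (Y j) * cellAvg (m + 1) L j ψ Y) X) * ψ X) := by
    have h := congrFun hB'B
    simp_rw [h]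
    rw [form_sum_left_bdd _ hw hwb (fun i _ => continuous_finsetSum _ fun j _ => hFb i j) hψ]
    exact Finset.sum_congr rfl fun i _ => form_sum_left_bdd _ hw hwb (fun j _ => hFb i j) hψ
  have e1 : (∫ X in cellN (m + 1) L, ((w X : ℝ) : ℂ) *
      (conj (∑ i, cellWave L n (X i) * cellAvg (m + 1) L i ψ X) * ∑ i, cellWave L n (X i) * cellAvg (m + 1) L i ψ X)) =
        ∑ i, ∑ j, ∫ X in cellN (m + 1) L, ((w X : ℝ) : ℂ) *
          (conj (cellWave L n (X i) * cellAvg (m + 1) L i ψ X) * (cellWave L n (X j) * cellAvg (m + 1) L j ψ X)) := by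
    rw [form_sum_left_bdd _ hw hwb (fun i _ => hb i) (continuous_finsetSum _ fun j _ => hb j)]
    exact Finset.sum_congr rfl fun i _ => form_sum_right_bdd _ hw hwb (hb i) (fun j _ => hb j)
  have e2 : (∫ X in cellN (m + 1) L, ((w X : ℝ) : ℂ) *
      (conj (∑ i, fourierAvg m L n i ψ X) * ∑ i, fourierAvg m L n i ψ X)) =
        ∑ i, ∑ j, ∫ X in cellN (m + 1) L, ((w X : ℝ) : ℂ) *
          (conj (fourierAvg m L n i ψ X) * fourierAvg m L n j ψ X) := by
    rw [form_sum_left_bdd _ hw hwb (fun i _ => hF i) (continuous_finsetSum _ fun j _ => hF j)]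
    exact Finset.sum_congr rfl fun i _ => form_sum_right_bdd _ hw hwb (hF i) (fun j _ => hF j)
  rw [e1, e2, e3, e4]
  simp only [Finset.sum_add_distrib, Finset.sum_sub_distrib]

end Adjoint

end PlainInteraction

/-- **Part 1 of `stub_bandEmptinessBdd` (registered helper statement)**: adjointness of the slot operator
`b_l f = e_n(x_l)·P_l f` against a BOUNDED MEASURABLE real weight `w` flat in slot `l` — for continuous `f, g`,
`∫ w conj(b_l f) g = ∫ w conj(f) P_l^{(n)} g` (`P_l` is self-adjoint with one bounded measurable entry, and `w`
passes through `P_l`). [folklore] (KennedyLiebShastry1988 §2; arXiv:1211.2778 §2; LSSY2005 App. A) -/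
theorem plainFormsBdd_form_up_adjoint : ∀ (m : ℕ) (L : ℝ) (n : Fin 3 → ℤ) (l : Fin (m + 1)) (w : Literature.MathematicalPhysics.QuantumManyBody.BoseGas.Config (m + 1) → ℝ) (C : ℝ), Measurable w → (∀ X, ‖w X‖ ≤ C) → (∀ (X : Literature.MathematicalPhysics.QuantumManyBody.BoseGas.Config (m + 1)) (z : Literature.MathematicalPhysics.QuantumManyBody.BoseGas.Space), w (Function.update X l z) = w X) → ∀ (f g : Literature.MathematicalPhysics.QuantumManyBody.BoseGas.Config (m + 1) → ℂ), Continuous f → Continuous g → ∫ X in Literature.MathematicalPhysics.QuantumManyBody.BoseGas.cellN (m + 1) L, ((w X : ℝ) : ℂ) * ((starRingEnd ℂ) (Literature.MathematicalPhysics.QuantumManyBody.BoseGas.cellWave L n (X l) * Summit.AtomisticToContinuum.BoseEinsteinCondensation.Theorems.GaussianDominationCan.Negative.cellAvg (m + 1) L l f X) * g X) = ∫ X in Literature.MathematicalPhysics.QuantumManyBody.BoseGas.cellN (m + 1) L, ((w X : ℝ) : ℂ) * ((starRingEnd ℂ) (f X) * Summit.AtomisticToContinuum.BoseEinsteinCondensation.Cruxes.GDTransfer.DysonDressedWitness.fourierAvg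 m L n l g X) :=
  fun _ _ n l _ _ hw hwb hwl _ _ hf hg => PlainInteraction.form_up_adjoint_bdd n l hw hwb hwl hf hg

end Summit.AtomisticToContinuum.BoseEinsteinCondensation.Cruxes.GDTransfer.Seeded

end
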